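import Mathlib
import HarnessLib
import HarnessLib.Audit
import Summits.QuantumFields.Statement
import Literature.MathematicalPhysics.QuantumLattice.LatticeTori
import HarnessLib.Audit.Status.Attr

/-!
Route: HeatSlicedQuarks

DORMANT since 2026-08-25T14:44:44Z (reconciler: no traction for 7.8 d (last activity item-evidence-added at 2026-08-17T19:17:27Z); parked, not closed — `ledger route dormant route-QuantumFields-HeatSlicedQuarks --off` to reactivate) — unstaffed, not closed; items shared with open routes are served there. `ledger route dormant <id> --off` reactivates.

# Route HeatSlicedQuarks — heat-kernel phase cells for Wilson quarks in Bałaban backgrounds: the two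
spectral engine theorems are PROVED; what is left of X₀ is the interleaved flow, entered through the
quark-loop coefficient read off the lattice heat kernel

X = ENGINE ∧ MILESTONES ∧ FLOW ∧ COMPLETION ("it suffices to show"). ENGINE (card
heat-sliced-quarks-davies-gaffney): slice the
Wilson quark covariance of the scale-j Bałaban BACKGROUND U_j by its own covariant heat semigroup,
C_j(U_j) = ∫ e^{−t D_W†D_W} D_W† dt over t ∈ [L^{2j}, L^{2j+2}]; off-diagonal locality and Gram form
are uniform in the
gauge field for free (DaviesGaffneyWilson, PROVED), on-diagonal free power counting t⁻² holds
wherever plaquettes are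
(ε/r²)-small on a K·r-ball (SmallFieldUltracontractivity, rank 2, PROVED 2026-08-16: comb gauge +
cut-off parametrix around
the free massive kernel closed as a sup-norm fixed point, 7 stubs) and excess low modes cost Wilson
action linearly
(ActionBoundsLowModes, rank 3, PROVED: Lieb–Thirring/CLR for Wilson fermions). With both spectral
cruxes closed the old
engine glue `InterleavedHeatSliceFlow : SFU → ABLM → X₀` is kernel-checked EQUIVALENT to X₀
(p96451), so it is SPLIT
(2026-08-16, this revision) into typed MILESTONES strictly weaker than X₀ that continue the landed
parametrix chain into the
marginal flow — TracedQuadraticParametrix (child crux of the rank-4 node: the colour–spin trace of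
the on-diagonal correction is O((ε/r²)²), the
size at which the quark loop lives), QuarkLoopCoefficient (child crux: in covariantly constant
Cartan flux the traced correction
IS P(x)/(6π²), P the plaquette-deficit density — the continuum Seeley–DeWitt a₂ of −D̸², i.e. the
−2N_f/3 in 16π²b₀ that
`HasAsymptoticScaling` pins inside X₀), QuarkSliceStability (support, PROVED 2026-08-17:
Bałaban-format lower stability of the quark slice, a
corollary of ABLM, consumed inside the flow) — and the FLOW glue (InterleavedFlowProper :
TracedQuadraticParametrix → QuarkLoopCoefficient →
InterleavedHeatSliceFlow: the interleaved Bałaban-SU(3) / GK–FMRS construction proper, honestly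
X₀-hard, its open content named item by item below). X₀ (ContinuumQCDExists, target): continuum
SU(3) QCD
with N_f = 2, 3 dynamical Wilson quarks along an asymptotically free, mass-independent scheme with
`HasMassScaling` —
`QCDOf` minus its two gap clauses and minus `reg.IsChiralAtZero` (the UV engine cannot see the
chiral point). COMPLETION
(RobustYangMillsHandover, rank 5, conditional flavour: X₀ → QCD by name): pinned threshold — X₀'s
own regularisation
re-pinned at the infimum P of its gapped offsets (kernel-checked `qcdOf_iff_pinnedThreshold`,
`exists_pin`,
`robustYangMillsHandover_of_pinInputs`); gaps above P = heavy-quark / robust-YM half (shared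
GradientFlowSpecies.MassiveLatticeGap),
chirality at P = Goldstone pair or anomalous Ward triple; live skeleton
`Cruxes/RobustYangMillsHandover/Lines/lee_yang_mass_handover.lean`.
Lean: `∀ Nf : ℕ, Nf = 2 ∨ Nf = 3 → ∃ reg :
Literature.MathematicalPhysics.QuantumFieldTheory.QCDRegularisation Nf, reg.HasMassScaling ∧ ∀ m :
Fin Nf → ℝ, (∀ f, 0 < m f) → ∃ (z shift : Literature.MathematicalPhysics.QuantumFieldTheory.QCDField
Nf → ℕ → ℝ) (T : Literature.MathematicalPhysics.QuantumFieldTheory.OSData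
(Literature.MathematicalPhysics.QuantumFieldTheory.QCDField Nf) 4),
Literature.MathematicalPhysics.QuantumFieldTheory.IsQCDAlong (reg.scheme m z shift) T ∧
T.IsNontrivial Literature.MathematicalPhysics.QuantumFieldTheory.QCDField.glue ∧ T.IsNonGaussian
Literature.MathematicalPhysics.QuantumFieldTheory.QCDField.glue ∧ ∀ f g : Fin Nf, f ≠ g →
T.IsNontrivial (Literature.MathematicalPhysics.QuantumFieldTheory.QCDField.pseudoRe f g)`

## Assembly
`closes : SmallFieldUltracontractivity → ActionBoundsLowModes → TracedQuadraticParametrix →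
QuarkLoopCoefficient → InterleavedFlowProper →
RobustYangMillsHandover → QCD` (pure logic, `h5 (h4g h4a h4b h2 h3)`, certified native at rev 8:
InterleavedHeatSliceFlow is now DERIVED,
not assumed). Cone after this revision: PROVED leaves 8871, 8872
(+ supports 8873–8877, 23 `--supports` files of the 8891 parametrix chain, 16 of 8892's line); OPEN
leaves =
TracedQuadraticParametrix, QuarkLoopCoefficient (typed lattice theorems, staffed; the coefficient
crux repaired once, 17986 → 16786, Davies–Gaffney tail),
QuarkSliceStability (support, PROVED, outside `closes`), the flow glue InterleavedFlowProper
(X₀-hard, see RANKED CRUXES) and RobustYangMillsHandover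
(X₀ → QCD). The route's complete uncertainty is therefore: two lattice spectral theorems of size L,
one corollary, and the
two summit-weight arrows FLOW (⇒ X₀) and COMPLETION (X₀ ⇒ QCD), each with its why-easier paragraph
and its registered
first lemmas; nothing else is assumed (no Literature fact in the cone is unproved;
BalabanUVStability4 is NOT imported — it is
schematic, SU(2), and not asserted in the tree, so the SU(3) gauge steps are open content of the
flow glue, said so).

Rationale: WHY THIS LINE. Heat-kernel (parametric) slicing is the fundamental phase-cell tool of the Rivasseau
school (Rivasseau1991 §II.1;
doi:10.1007/bf01208817, doi:10.1007/bf01464282 — Gawędzki–Kupiainen and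
Feldman–Magnen–Rivasseau–Sénéor for fermions with Gram bounds);
done with the COVARIANT semigroup of the background it keeps gauge covariance and real-analyticity
in U, and since 2026-08-16 the two
facts that make it an engine for Wilson quarks in rough dynamical SU(3) fields are THEOREMS of the
tree: U-uniform off-diagonal
locality (8873) and scale-covariant on-diagonal free power counting (8871, the tier-deciding crux:
comb gauge, cut-off parametrix
around the free MASSIVE kernel, sup-norm fixed point; every Disproof obstruction honoured), plus the
Lieb–Thirring/CLR count that
charges every excess low mode to the Wilson action (8872). WHY THE REMAINING FORM IS EASIER than X₀
attacked cold (rubric axis 1,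
stated precisely): (i) the fermion sector now enters any multiscale construction ONLY through
objects with background-free
constants — Gram-representable slices (det-bounds without factorials, FixedSignFactorialDivergence
does not touch the fermion
sector), kernels real-analytic in the complexified background with explicit strips (landed
`stub_holomorphicGaugeCovariance` p85892,
`stub_squareRootStrip` p89245, `stub_squareDissipativity` p85721 — Bałaban-type analyticity domains
for the quark slice), an
O(δ) column identification (p111007) and a log-corrected diagonal parametrix (p112612); (ii) the
marginal coupling between quarks
and the gauge flow is reduced to ONE universal number, the F²-coefficient of the traced Wilson heat
kernel, which the new crux
QuarkLoopCoefficient pins to P(x)/(6π²) = the continuum a₂ (background-field method, Abbott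
doi:10.1016/0550-3213(81)90371-0;
lattice Λ-parameter matching for Wilson quarks, Kawai–Nakayama–Seo
doi:10.1016/0550-3213(81)90080-8), and whose non-perturbative
O(δ²) frame is TracedQuadraticParametrix; (iii) what is then left — SU(3) Bałaban gauge steps at the
quark-shifted running coupling,
the RELEVANT mass vertex m_crit(k) and marginal Z_m(k) tuned in-flow, convergence and OS — is the
configuration Dimock closed for
QED in d = 3 with Bałaban's method INCLUDING dynamical gauge field, fermion determinant slices and
in-flow counterterms
(doi:10.1063/1.5009458, doi:10.1063/1.5134439, doi:10.1007/s00023-021-01127-z; trilogy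
doi:10.1142/s0129055x13300100,
doi:10.1063/1.4821275, doi:10.1007/s00023-013-0303-3) and Bałaban closed for pure SU(2) gauge fields
in d = 4 (CMP 109/119/122;
tree `BalabanUVStability4`, schematic and NOT asserted — the SU(3) instance is open content of this
route, declared). Named tools,
real precedent one dimension / one gauge group down; the d = 4 non-abelian fermion–fluctuation
vertex has NO precedent and is the
honest summit-weight residue (NewLever is the engine + the heat-kernel reading of b₀, not the
residue). Imported areas: heat kernels
on graphs (Davies, Carne–Varopoulos, Delmotte), spectral counting (CLR/Lieb–Thirring,
Rozenblum–Solomyak doi:10.1007/s10958-009-9436-9),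
Seeley–DeWitt asymptotics (Vassilevich doi:10.1016/j.physrep.2003.09.002), constructive multiscale
fermion expansions, Bałaban RG.

RANKED CRUXES. #2 SmallFieldUltracontractivity — PROVED (closed 2026-08-16T14:53Z;
`Theorems/HeatSlicedQuarksSmallFieldUltracontractivity.lean`,
`…Cruxes.SmallFieldUltracontractivity.PointCentredAxialParabolic.SmallFieldUltracontractivity_of`,
stubs p90661 p88740 p87364 p92668 p87054
p87327 p91576 + gauge transfer / covariance / monotone). #3 ActionBoundsLowModes — PROVED
(`…Cruxes.ActionBoundsLowModes.DropTheWilsonSquare.ActionBoundsLowModes_of`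
@ d24e4ea7738f). #4 InterleavedHeatSliceFlow (`SFU → ABLM → X₀`) — SPLIT NODE: with #2, #3 closed it
is ≡ X₀ (p96451
`interleavedHeatSliceFlow_iff_continuumQCDExists`; line `Sketch` landed 23 support files and died at
`stub_transfer = X₀`, lead c4
16:47Z, `Lines/Sketch.dead.md`), so this revision decomposes it (one active decomposition, two
layers) into —
 (4a) TracedQuadraticParametrix [crux, rank 6, item 17985, L]: under global (ε/r²)²-smallness, m ∈
[−1/2,1], the colour–spin TRACE of
 [e^{−tH_U} − e^{−tH_1}](x,x) is ≤ C(ε/r²)² uniformly in 1 ≤ t ≤ r² (+ the landed winding tail):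
su(3) is traceless, so the
 linear column-Duhamel term dies in the trace and what survives is Re tr(W−1) = −(link deficit) plus
the two-vertex term,
 both δ² = ε²/r⁴ — the order at which the quark loop's F² coefficient lives (untraced entries are
only O(εt/r²)/t², landed
 p112612, one power of ε short at t ≍ r²). Monday morning: second-order column Duhamel with the
landed GlobalCombGauge p105426,
 HoppingWeightedBounds p106391, FreeColumnProfile p105317, FreeWeightedMoments p105810,
ColumnIdentification p111007.
 (why it might fail: Re tr(W−1) ≍ (d+1)²δ² grows with d² in the comb gauge and eats a factor t of
the smoothing budget; a log t
 loss as in the retired r3 ParametrixCore breaks uniformity exactly at t ≍ r².)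
 (4b) QuarkLoopCoefficient [crux, rank 7, item 16786 (= 17986 REPAIRED 2026-08-17T00:24Z by
route-repair after the flat-toron refutation: the
 finite-volume tail is the Davies–Gaffney envelope, not a Gaussian), M/L]: for Cartan-diagonal SU(3)
fields with constant plaquette diag(e^{iθ},e^{−iθ},1) in one
 plane and all other plaquettes trivial, |Σ_{a,α}Re[e^{−tH_U} − e^{−tH_1}](x,x) − (1−cos θ)/(3π²)| ≤
Cθ²(1/t + θ²t²) + Ce^{−cL²/(t+L)}/t²
 for 1 ≤ t ≤ L², t|θ| ≤ 1 (massless Wilson operator; Polyakov phases free, entering only through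
winding images inside the envelope): the traced correction is t-INDEPENDENT and equals P(x)/(6π²),
the continuum
 Seeley–DeWitt a₂ of −D̸² on spinors ⊗ fundamental ((4πt)⁻²t²tr a₂ = (1/12π²)Σ_{μ<ν}‖F_{μν}‖²,
paramagnetic; Landau check
 ft coth ft − 1 = (ft)²/3(1 − (ft)²/15)); dictionary −N_f ln det D_W ⊃ (N_f/2)∫dt/t Σ_x trK ⇒ Δβ =
(N_f/2π²)log(1/(am)), i.e.
 exactly the −2N_f/3 in 16π²·betaCoeff₀ N_f that `IsQCDAlong.HasAsymptoticScaling` pins INSIDE X₀ —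
the flow must reproduce this
 number from the fermionic slices, and by the background-field method the covariantly constant field
is where it is read.
 Monday morning: Fourier–Landau analysis of the lattice Pauli–Wilson operator in constant abelian
flux (Harper blocks), second
 order in θ with the exact continuum limit of the a₂ coefficient; numerics kit j020890/j020932
(exact block diagonalisation,
 12²×24² … 192×20×16² tori; evidence on item 17986). (why it might fail: the t⁰ coefficient must be
EXACTLY the continuum a₂ with a log-free O(θ²/t) lattice remainder; free Polyakov
 phases / AB-scrambled images must fit e^{−cL²/(t+L)}/t² (flat slice checked exactly by the repair
seat); uniformity on θt ≤ 1 needs Harper blocks;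
 the number itself is now confirmed numerically in infinite volume to < 0.5 % (refuter kit
j021094/j021156) and on tori to 2 % (planner j020932).)
 (4s) QuarkSliceStability [support, item 17987, PROVED 2026-08-17
(`Theorems/…QuarkSliceStability_proof` @ 6c89f7ebf22c) — from #3 by Laplace transform of the mode
count]: ∫_s^{bs}(Tr e^{−tH_U} −
 Tr e^{−tH_1})dt/t ≤ CL⁴/s² + C(S_W(U)+1)log b for ALL U — the fermionic factor of Bałaban's lower
stability bound e^{−c|Λ|} ≤ ρ_k
 (extensive constant per √s-block + a log b·S_W shift paid by the same plaquette action as the gauge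
weight).
 (4g) InterleavedFlowProper [glue (4a) → (4b) → InterleavedHeatSliceFlow — the support (4s) is
consumed inside its proof — X₀-HARD, declared, item 18031]: the interleaved construction
 itself — Bałaban SU(3) block-averaging steps (CMP 109/119/122; SU(3) d = 4 instance open, tree
predicate schematic) at the
 quark-shifted running coupling β_j + (N_f/2π²)·log, GK/FMRS slice integrations with the
Gram/analytic slices of the ENGINE, in-flow
 tuning of the relevant m_crit(k) (linear) and marginal Z_m(k) (exponent massExponent N_f,
`HasMassScaling`), then the limit:
 convergence of `qcdLatticeSchwinger` along the sequence for all mass tuples at once (equicontinuity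
in m), OS E0–E4 (E2 from
 Osterwalder–Seiler/Lüscher positivity of Wilson fermions at m_f(k) > −1; E1 rotations and E4
clustering at m > 0 are NOT automatic
 and are shared with the YangMills rotation cruxes / the GapBuysCauchyRate ladder), non-triviality
and non-decoupling from the AF
 short-distance expansion ⇒ ContinuumQCDExists. WHY THIS FORM IS EASIER than X₀ cold (it is X₀ given
three lattice theorems, declared,
 not hidden): after (4a)/(4b)/(4s) and the proved engine the fermion sector enters the construction
only through CERTIFIED inputs — Gram/analytic
 slices with background-free constants, an O(δ²) traced parametrix, one universal marginal number, a
Bałaban-format stability bound — so the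
 glue is "Bałaban's pure-gauge analysis for SU(3) + a GK/FMRS sector whose power counting is settled
+ one relevant vertex", precisely the
 configuration closed one dimension down with an abelian group (Dimock QED₃) and, for the gauge
half, one group down in d = 4 (Bałaban SU(2));
 the residue without precedent is the d = 4 non-abelian fermion–fluctuation vertex and E1. (why it
might fail: no fermionic multiscale
 expansion with a DYNAMICAL non-abelian gauge field in d = 4 exists; the rough fermion–fluctuation
vertex carries the linearly divergent mass shift scale by scale; large
 fields cut the Gram strips; E1 is open even for pure YM.) [Balaban1987RG1, Balaban1988Convergent,
Balaban1989LargeFieldII,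
 BalabanOcarrollSchor1989, doi:10.1063/1.529479, doi:10.1007/s00023-021-01127-z, Rivasseau1991]
#5 RobustYangMillsHandover (`X₀ → QCD`, conditional flavour; verdict misstated after the re-type
p117723, repaired by the PINNED
THRESHOLD, kernel-checked `qcdOf_iff_pinnedThreshold` / `exists_pin` /
`robustYangMillsHandover_of_pinInputs` in
`Theorems/HeatSlicedQuarksRobustYangMillsHandoverPinnedThreshold.lean`): why-easier = the completion
is CUT at the infimum P of X₀'s
own gapped offsets, so "gaps above P" is the heavy-quark / robust-YM half by definition of P (shared
item GradientFlowSpecies.MassiveLatticeGap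
8922; lattice → species Cauchy–Schwarz clustering → continuum gap by the landed
`IsQCDAlong.hasMassGap_of_hasSpeciesCSClustering`,
converse transfer p127662, gap-free truncated Schwarz engine p129979) and chirality at P is "no
uniform lattice rate just above P"
(Goldstone pair, or anomalous Ward triple with tree decay — items 16261/16262 LANDED p127308); live
lead c8 on
`Lines/lee_yang_mass_handover.lean` gen 4.3, 16 support files landed (two-constants p124094,
biaffine p124742, tree-decay germ, cell
Dobrushin decay, cluster deployment, species gap transfer …), 5 open stubs each audited (heavyHalf =
8922, latticeToSpeciesCS = 8923,
gaplessTuple / dataBelowPin / wardTripleAtPin = open light-quark physics). (why it might fail: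
contains SU(3) robust Yang–Mills AND a
chiral point on X₀'s bare trajectory with gaps at every mass above it; a first-order endpoint with a
k-uniform gap on the Wilson mass
axis refutes every same-regularisation completion, `not_isChiralAtZero_of_uniform_gap`.) #0
ContinuumQCDExists (target) unchanged.
Supports #9 DaviesGaffneyWilson, WilsonLichnerowicz, AccretiveWilsonDirac,
UniformLocalSpectralBound, FreeKernelPowerCounting — all PROVED.

KILL CRITERIA. (K1, new, cheapest, runs now) QuarkLoopCoefficient: exact diagonalisation in constant
Cartan flux — if the
traced t⁰ coefficient is NOT (1 − cos θ)/(3π²) within the stated O(θ²/t + θ⁴t²) (kit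
j020890/j020932: so far it IS, to 2 %), the heat-slice flow cannot
deliver `HasAsymptoticScaling` with betaCoeff₀ N_f through its fermionic slices as cut: restate (4b)
with the measured lattice
coefficient and re-examine the Wilson-term artefact, or close the engine→X₀ arrow
`refuted:QuarkLoopCoefficient`. (K2) ¬TracedQuadraticParametrix
by a rough (ε/r²)²-small family whose TRACED diagonal correction exceeds ε²/r⁴ by log t or worse at
t ≍ r²: the quark loop is not
readable slice by slice at the size the flow needs — restate with the log and pay it in the coupling
flow, or pivot (4a)/(4b) to
block-averaged coefficients. (K1′, SPENT) the first typing of the coefficient crux (17986, Gaussian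
tail Ce^{−cL²/t}/t²) was refuted-misstated within 20 min by the FLAT
TORON (Cartan links diag(e^{iπ/L},e^{−iπ/L},1) in one direction: all hypotheses hold with θ = 0,
odd-winding images ≥ 32e^{−2}/(L³L!) at t = 1 beat
any Gaussian-in-L tail; Toron.lean rc 0) and repaired as 16786 with the Davies–Gaffney envelope —
negative knowledge for every lattice
heat-kernel statement of the route: finite-volume tails are e^{−cL²/(t+L)} (Poissonian t^L/L! for t
≲ L), never Gaussian. (K3) 8871/8872 are theorems;
the old kill lines for them are retired. (K4) Since the re-type: a proof
that some X₀-honest regularisation is UNIFORMLY lattice-gapped at every real offset of its Wilson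
mass axis (first-order endpoint
with k-uniform gap) refutes both chirality suppliers of #5 and every same-regularisation completion
— then restate 8870 to X₀^χ
(chirality tuned in-flow) or close `refuted:RobustYangMillsHandover`; a refutation of
GradientFlowSpecies.MassiveLatticeGap (8922)
kills the heavy half here too. (K5) YangMills(SU(3)) refuted, or robust YM failing under arbitrarily
small quasi-local perturbations,
moots X₀ → QCD for every unquenched route. (K6) A proof that E1 cannot be restored along any
hypercubic Wilson scheme with
`HasAsymptoticScaling` kills the flow glue (and every lattice route of the summit).

NOT DECOMPOSED YET. Inside the flow glue (4g), deliberately (two-layer rule; they become registered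
stubs of its line, not items):
the sliced Gram/determinant bound det[C_ℓ(x_i,y_j)] ≤ (Cℓ⁻³)ⁿ (corollary of 8871 + γ₅-hermiticity +
T*T, provable now); the general
smooth-background form of (4b) (|∇ᵏF| ≤ ε/r^{2+k}, k ≤ 2, local a₂ identification with relative
error t/r² + 1/t + ε — needs
transported plaquette differences typed); the one-step fermionic integration in a fixed background
with the in-flow mass vertex;
the SU(3) extension of Bałaban's small/large-field gauge step; uniformity in k; OS repackaging
(E1/E4) and non-triviality lower
bounds; continuity in the mass tuple for one sequence a_k. Inside #5: the chiral completion (pin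
existence, light-quark continuum
data above the pin, chirality at the pin) — registered stubs of `lee_yang_mass_handover`, audited,
two of them shared items (8922, 8923).
Definition request standing: `QuasiLocalGaugePerturbation` (for #5's robust-YM class).

CHEAPEST FALSIFIER. RUN THIS SESSION (script numerics/a2_batch.py, planner folder; block-exact
spectra of H = D_WᴴD_W, transverse momenta
conserved, BLAS threads pinned): kit j020890 (done) — (i) constant flux n = 1 on 12²×24² and 16²×20²
tori, m = 0: the site-averaged spin-traced
Δ(t) = [K_U − K_1](x,x)/θ² = 0.92–0.94 × 1/(12π²) at t = 2–4 (lattice artefacts at the 6–8 % level,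
right sign = paramagnetic, right
magnitude), then a NEGATIVE drift setting in at θt ≈ 0.3 that scales with t/L², quantitatively the
Aharonov–Bohm-scrambled winding images of
the charged kernel (deficit ≈ 4e^{−L²/4t}K_1^∞: L = 16, t = 16: 7.2e-6 predicted vs 8.9e-6 seen; t =
24: 1.2e-5 vs 1.4e-5) — i.e. exactly the
C e^{−cL²/t}/t² term of the typed statement (c ≤ 1/4), NOT a failure of the coefficient; (ii) slowly
varying wave U(x,1) = e^{0.4i sin(2πx₀/64)}:
Δ(t)(x₀) tracks φ(x₀)² site by site with corr = 1.0000 and coefficient 0.92–0.94/(12π²) for t ≤ 6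
(LOCALITY of the coefficient confirmed), then
the same x₁-winding contamination (L₁ = 16, phases e^{16iA₁(x₀)}) — visible as suppression
correlated with |A₁(x₀)|, not with φ. CLEAN WINDOW
(kit j020932, done): twist-free Landau gauge on a 192×20×16² torus (θ = 2π/192 decoupled from the
flux-plane cycle, charged x₁-images average
to zero): Δ/θ²/(1/12π²) = 0.923, 0.939, 0.949, 0.959, 0.964, 0.969, 0.974, 0.989, 1.010 at t = 2, 3,
4, 6, 8, 10, 12, 16, 20 — a monotone
O(1/t) approach to 1 (≈ 1 − 0.16/t); normalised by the measured free kernel and corrected for the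
free kernel's own x₁-images the coefficient is
1.00 ± 0.02 for t = 8–20; the m = 1/4 run decays with the massive free kernel (quarks drop out of
the running below their mass, as they must).
PASSED: the cheapest falsifier of the new rank-7 crux has been run and the coefficient is the
continuum a₂ within 2 % on tori; INDEPENDENTLY the
crux-attack refuter's infinite-volume magnetic-cell Bloch reduction (kit j021094/j021156, θ = 2π/q,
q ≤ 384, t ≤ 60) finds the lattice a₂ coefficient
→ (1 − cos θ)/(3π²) to < 0.5 %, θ → 0 deficit = 0.25/t (so the Cθ²/t budget shape is right) and the
θ-dependence inside Cθ⁴t². KILL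
READING (K1): the t → ∞, L → ∞ limit of Δ/θ² must be EXACTLY 1/(12π²) per unit charge per plane — a
plateau at 0.93/(12π²) surviving t → ∞
would refute QuarkLoopCoefficient as typed (the Cθ²/t allowance vanishes) and with it the
b₀-matching of the flow; the present data show the
ratio still rising at t = 4 (0.92 → 0.94) before images intervene, consistent with O(1/t) artefacts.
Earlier falsifiers for 8871/8872 are
superseded by their proofs.

TWO-LAYER PLAN. Layer 1: 8871 ✓, 8872 ✓, supports ✓. Layer 2 (this revision):
InterleavedHeatSliceFlow ⇐ TracedQuadraticParametrix (17985, lead prover's 7-stub skeleton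
registered 01:19Z) →
QuarkLoopCoefficient (16786, repaired) → (glue InterleavedFlowProper 18031, lead + crux-ideation
live), with the support QuarkSliceStability (17987,
PROVED 2026-08-17 `QuarkSliceStability_proof` @ 6c89f7ebf22c) beside them; RobustYangMillsHandover
carries its decomposition as the
registered skeleton `lee_yang_mass_handover` (HeavyHalf = 8922 shared → PinnedContinuumData →
LatticeToSpeciesCS = 8923-type →
ChiralAtPin), to be filed `--glue-by robustYangMillsHandover_of_pinInputs` once one chirality
supplier survives audit. No third layer.

NUMBERS. b₀ = (11 − 2N_f/3)/(16π²); quark loop per flavour: Δ(1/g²) = (1/12π²)log(Λ/m), Δβ =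
6Δ(1/g²) = (N_f/2π²)log(1/(am));
heat kernel: tr_s a₂(−D̸²) = (4/3)Σ_{μ<ν}‖F_{μν}‖²_HS, (4πt)⁻²t²tr_{s}a₂ = (1/12π²)Σ_{μ<ν}‖F‖²,
lattice 3 − Re tr U_p = ½‖a²F‖²_HS ⇒
tr_{c,s}ΔK → P(x)/(6π²) = 0.016887·P(x); Cartan embedding diag(e^{iθ},e^{−iθ},1): Σq² = 2, P =
2(1−cos θ). Landau: ft coth ft =
1 + (ft)²/3 − (ft)⁴/45. γ₀/(2β₀) = 12/(33 − 2N_f) (`massExponent`, = 4/9 at N_f = 3). Free Wilson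
kernel: spin-traced K_1(t)(x,x)·4π²t² → 1.
Items after this revision: 15 (1 target; cruxes 8871 ✓ 8872 ✓, 8891 (now derived), its milestones
17985 16786 + glue 18031, 8892; supports
17987 ✓ + 8873–8877 ✓; 1 assembly) — at the cap, by design: further depth lives in registered lines.
(`--split` is refused outside a final cycle,
so the decomposition was filed as add_items + a re-certified `closes`; one active decomposition of
8891, two layers.)

DEFINITION REQUESTS. `QuasiLocalGaugePerturbation`
(Literature/MathematicalPhysics/QuantumFieldTheory, next to `ConstructiveQFTBalabanRG`)
— unchanged, for #5. None needed for the new items: heat kernels are `NormedSpace.exp` of `Dᴴ * D`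
over the tree's `wilsonDirac`,
traces `Matrix.trace`, the slice integral an `intervalIntegral`, plaquettes `plaquetteHolonomy`, the
action `wilsonAction`;
Sketch.lean with the three children elaborates rc 0 against the route file (planner folder).

Novelty: Searches (2026-08-15): `lit search --hybrid "heat kernel Gaussian upper bounds graphs bounded range
operators Davies large deviations"` (10: davies1989,
barlow2017 — read Thm 4.9, (4.20), Thm 5.17, Thm 6.29 — chung1997; pure analysis); `lit search
--hybrid "sliced propagator parametric representation …
Gram inequality fermions"` (8: rivasseau1991 — read §I.3.C p.26, §II.1 pp.52–53 — mastropietro2008,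
montvay1994); `lit search --source zbmath "Wilson
Dirac operator spectrum bounds"` (1: Adams hep-lat/9907005); `lit search --source crossref` for
Neuberger 2000 / Adams 2003 / Bałaban CMP 95, 99 /
BOS 1989, 1991 / GK 1985 / FMRS 1986 / Rozenblum–Solomyak 2009 (ids below); `lit galaxy search
"Wilson-Dirac operator" | "propagators for lattice gauge
theories in a background field" | "Lieb-Thirring inequality lattice" --star all` (12 / 0 / 0 rows,
numerics and HPC only); `lit frontier QuantumFields
--since 2021` (30 rows: stochastic/2D YM, YM–Higgs Gaussian limits, no constructive fermion RG);
openalex/arxiv/s2 rate-limited this hour (logged);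
`ledger idea list --sub QCD` (52 cards, none routed; fermionic UV step unresolved in four cards);
`ledger negatives` (0).
Nearest prior art found: Rivasseau1991 §II.1 and doi:10.1007/bf01208817, doi:10.1007/bf01464282
(heat-kernel/phase-cell slicing with Gram bounds, flat
space, no gauge field); doi:10.1007/bf01240355, doi:10.1007/bf01215753, doi:10.1063/1.529479
(Bałaban / BOS propagators in lattice background fields by
block averaging, not he  [refs: 10.1007/bf01208817, 10.1007/bf01464282, 10.1007/bf01240355, 10.1007/bf01215753, 10.1063/1.529479, 10.1017/9781107415690, 10.1112/jlms/s2-47.1.65, 10.1103/physrevd.61.085015, 10.1103/physrevd.68.065009, doi:10.1007/bf01208817, doi:10.1007/bf01464282, doi:10.1007/bf01240355, doi:10.1007/bf01215753, doi:10.1063/1.529479, doi:10.1017/9781107415690, doi:10.1112/jlms/s2-47.1.65, doi:10.1103/physrevd.61.]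

Barriers (technique_class: covariance-slicing, heat-kernel-bounds, spectral-counting): - technique_class: covariance-slicing, heat-kernel-bounds, spectral-counting
- Literature.Barriers.QuantumFields.HoppingExpansionUniformGap: evaded — no expansion in κ anywhere
above the quark scale; locality comes from Carne–Varopoulos/Davies–Gaffney for e^{−tH_U} (valid at
every κ, through κ_c(β)) and power counting from crux 2; the heavy hopping expansion appears only in
RobustYangMillsHandover below 1/m_f, inside its disc legitimately.
- Literature.Barriers.QuantumFields.BanksCasherCriterion: respected and used —
UniformLocalSpectralBound shows the U-uniform worst case IS the Banks–Casher rate t^{−1/2}; crux 2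
claims t⁻² only under scale-covariant smallness (UV regime of smooth backgrounds), never at hadronic
scales or for rough fields.
- Literature.Barriers.QuantumFields.VafaWittenEigenvalueBound: consistent — no spectral gap of D_W
is claimed anywhere; crux 3 bounds the number of low modes from ABOVE by λ²L⁴ + action, compatible
with Vafa–Witten's lower Weyl count; positive renormalised masses supply the infrared.
- Literature.Barriers.QuantumFields.UVStabilityNonUniqueness: conceded in form — the engine yields
stability bounds and subsequential limits; the statement's sequential continuum limit (ruling Y2)
makes that sufficient for X₀ except for the all-m uniformity flagged in the target's failure line.
- Literature.Barriers.QuantumFields.LinearDivergenceRenormalon: respected — m_crit(k) is tuned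
non-perturbatively inside the flow (InterleavedHeatSliceFlow), never by a

History (route lifecycle, newest last):
- 2026-08-16T23:48:32Z · rev 7: restated InterleavedFlowProper (stmt-QuantumFields-17988) — fix blocked item 17988: the glue must not reference the later-rendered support decl QuarkSliceStability (rank 9); hypotheses are the two new cruxes, the support (planner-promote-QuantumFields-HeatSlicedQuarks-a957f707-0)
- 2026-08-17T00:24:19Z · rev 10: restated QuarkLoopCoefficient (stmt-QuantumFields-17986) — repair: QuarkLoopCoefficient (stmt-QuantumFields-17986) refuted-misstated by the flat toron at θ = 0 (refuter-rattack-stmt-QuantumFields-17986-0: Toron.lean rc0 (planner-rrefute-QuantumFields-HeatSlicedQuarks-113185c2-0)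
- 2026-08-25T14:44:44Z · DORMANT — reconciler: no traction for 7.8 d (last activity item-evidence-added at 2026-08-17T19:17:27Z); parked, not closed — `ledger route dormant route-QuantumFields-He (operator:999:2264420)

sub-problem: QCD · status: dormant · opened planner-plancard-QuantumFields-QCD-heat-slice-3d639a15-0 2026-08-15T13:35:51Z · rev 13 · ledger route-QuantumFields-HeatSlicedQuarks
GENERATED by the gate from the ledger (D-0016/17). Provers cite these decls: `theorem foo : Summit.QuantumFields.QCD.Theses.HeatSlicedQuarks.<Decl> := …` in Summits/QuantumFields/QCD/Theorems/<Name>.lean.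
-/

namespace Summit.QuantumFields.QCD.Theses.HeatSlicedQuarks

open scoped BigOperators Topology Manifold Classical MeasureTheory ProbabilityTheory Matrix InnerProductSpace ComplexConjugate ContinuousMap
open Filter Set Function TopologicalSpace MeasureTheory

attribute [summit_statement] _root_.QCD

/-- item stmt-QuantumFields-8870 · target · rank 0 · open · by planner
why it might fail: it is continuum QCD existence itself: beyond the fermionic engine it needs SU(3) Bałaban UV stability with the quark loop in b₀, convergence not just stability (UVStabilityNonUniqueness), and one sequence a_k serving ALL mass tuples (continuity in m).
sources: JaffeWitten2000, Balaban1988Convergent, Balaban1989LargeFieldII, BalabanOcarrollSchor1989, MontvayMunster1994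
[target] X₀ — for N_f = 2 and N_f = 3 there is a mass-independent `QCDRegularisation` with
`HasMassScaling` such that for every tuple of positive renormalised masses some species
renormalisations and OS data T satisfy `IsQCDAlong` (AF Wilson scheme, sequential continuum limit),
with non-trivial non-Gaussian glue and every flavour-changing pseudoscalar non-trivial: `QCDOf`
without its two gap clauses; the deliverable of the engine (cruxes 2–4). -/
@[route_item "route-QuantumFields-HeatSlicedQuarks", crux]
def ContinuumQCDExists : Prop :=
  ∀ Nf : ℕ, Nf = 2 ∨ Nf = 3 → ∃ reg : Literature.MathematicalPhysics.QuantumFieldTheory.QCDRegularisation Nf, reg.HasMassScaling ∧ ∀ m : Fin Nf → ℝ, (∀ f, 0 < m f) → ∃ (z shift : Literature.MathematicalPhysics.QuantumFieldTheory.QCDField Nf → ℕ → ℝ) (T : Literature.MathematicalPhysics.QuantumFieldTheory.OSData (Literature.MathematicalPhysics.QuantumFieldTheory.QCDField Nf) 4), Literature.MathematicalPhysics.QuantumFieldTheory.IsQCDAlong (reg.scheme m z shift) T ∧ T.IsNontrivial Literature.MathematicalPhysics.QuantumFieldTheory.QCDField.glue ∧ T.IsNonGaussian Literature.MathematicalPhysics.QuantumFieldTheory.QCDField.glue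 ∧ ∀ f g : Fin Nf, f ≠ g → T.IsNontrivial (Literature.MathematicalPhysics.QuantumFieldTheory.QCDField.pseudoRe f g)

/-- item stmt-QuantumFields-8871 · crux · rank 2 · closed · proved by Summit.QuantumFields.QCD.Cruxes.SmallFieldUltracontractivity.PointCentredAxialParabolic.SmallFieldUltracontractivity_of (prover) · by planner
why it might fail: needs a lattice Uhlenbeck/Landau gauge on the ball with ‖A‖ ≤ Cε/r AND ‖∇A‖ ≤ Cε/r² from plaquette smallness alone (Bałaban builds such gauges with averaging); axial gauges give ∇A ~ ε/r and the Duhamel series diverges like (εr)ⁿ; D_W†D_W is not Markovian, so Nash/Kato give only t⁻¹, no shortcut.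
sources: doi:10.1007/bf01240355, doi:10.1007/bf01466594, doi:10.1007/bf01215753, Davies1989, doi:10.1063/1.529479, HernandezJansenLuscher1999
[crux] SCALE-COVARIANT SMALL-FIELD ULTRACONTRACTIVITY (card K1, recalibrated): there are ε > 0, K ∈
ℕ, C such that for every torus side L, every SU(3) configuration U, every bare mass m ∈ [−1/2, 1],
every site x and scale 1 ≤ r ≤ L, if all plaquettes based in the torus ball of radius K·r around x
satisfy 3 − Re tr U_p ≤ (ε/r²)², then every colour–spin entry of the on-diagonal heat kernel of H_U
= D_W(U,m,1)†D_W(U,m,1) obeys |e^{−tH_U}((x,a,α),(x,b,β))| ≤ C/t² for 1 ≤ t ≤ r² — free Dirac power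
counting of the slice at scale √t in ANY background smooth at that scale, constants
background-independent. [difficulty: L] -/
@[route_item "route-QuantumFields-HeatSlicedQuarks", crux]
def SmallFieldUltracontractivity : Prop :=
  ∃ ε : ℝ, 0 < ε ∧ ∃ K : ℕ, ∃ C : ℝ, ∀ (L : ℕ) [NeZero L] (U : Literature.MathematicalPhysics.QuantumFieldTheory.GaugeConfig 4 L (Matrix.specialUnitaryGroup (Fin 3) ℂ)) (m : ℝ), m ∈ Set.Icc (-(1 / 2 : ℝ)) 1 → ∀ (x : Literature.Probability.LatticeModels.TorusSite 4 L) (r : ℕ), 1 ≤ r → r ≤ L → (∀ y : Literature.Probability.LatticeModels.TorusSite 4 L, Literature.MathematicalPhysics.QuantumLattice.torusDist x y ≤ K * r → ∀ μ ν : Fin 4, 3 - ((Literature.MathematicalPhysics.QuantumLattice.fundamentalRep (Fin 3)) (Literature.MathematicalPhysics.QuantumFieldTheory.plaquetteHolonomy U y μ ν)).trace.re ≤ (ε / (r : ℝ) ^ 2) ^ 2) → ∀ (t : ℝ), 1 ≤ t → t ≤ (r : ℝ) ^ 2 → ∀ (a b : Fin 3) (α β : Fin 4), ‖(NormedSpace.exp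 (-(t : ℂ) • (Matrix.conjTranspose (Literature.MathematicalPhysics.QuantumLattice.wilsonDirac (Literature.MathematicalPhysics.QuantumLattice.fundamentalRep (Fin 3)) U m 1) * Literature.MathematicalPhysics.QuantumLattice.wilsonDirac (Literature.MathematicalPhysics.QuantumLattice.fundamentalRep (Fin 3)) U m 1))) (x, a, α) (x, b, β)‖ ≤ C / t ^ 2

/-- item stmt-QuantumFields-8872 · crux · rank 3 · closed · proved by Summit.QuantumFields.QCD.Cruxes.ActionBoundsLowModes.DropTheWilsonSquare.ActionBoundsLowModes_of @ d24e4ea7738f (prover) · by planner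
why it might fail: CLR fails for Pauli-type operators in low dimension (Aharonov–Casher); here d = 4 and the index is action-bounded, but the form bound ½K_U ≤ H_U + C·V_F must hold with ABSOLUTE C down to m = −1/2, and a discrete MAGNETIC CLR for the 12-component bundle Laplacian on the torus is unrecorded.
sources: VafaWitten1984CMP, doi:10.1007/s10958-009-9436-9, doi:10.1103/physrevd.61.085015, doi:10.1103/physrevd.68.065009, HernandezJansenLuscher1999, Luscher1982Topology
[crux] EXCESS LOW MODES COST WILSON ACTION (card K2 made deterministic; Courant–Fischer form): there
is C such that for every L, U, m ∈ [−1/2, 1], λ ≥ 0 and every complex subspace E of quark fields on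
which ‖D_W(U,m,1)v‖² ≤ λ‖v‖², dim E ≤ C·(λ²L⁴ + S_W(U) + 1), S_W = Σ_p (3 − Re tr U_p) the tree's
`wilsonAction` — a Lieb–Thirring/CLR inequality for Wilson fermions: beyond the free Weyl count λ²L⁴
every near-zero mode of D_W†D_W is paid for by O(1) of plaquette action, so Bałaban's e^{−β·(local
action)} large-field weights control the fermionic bad blocks linearly in their mode count. [deps:
WilsonLichnerowicz] [difficulty: L] -/
@[route_item "route-QuantumFields-HeatSlicedQuarks", crux]
def ActionBoundsLowModes : Prop :=
  ∃ C : ℝ, ∀ (L : ℕ) [NeZero L] (U : Literature.MathematicalPhysics.QuantumFieldTheory.GaugeConfig 4 L (Matrix.specialUnitaryGroup (Fin 3) ℂ)) (m : ℝ), m ∈ Set.Icc (-(1 / 2 : ℝ)) 1 → ∀ (lam : ℝ), 0 ≤ lam → ∀ (E : Submodule ℂ (Literature.Probability.LatticeModels.TorusSite 4 L × Fin 3 × Fin 4 → ℂ)), (∀ v ∈ E, ∑ i, ‖(Literature.MathematicalPhysics.QuantumLattice.wilsonDirac (Literature.MathematicalPhysics.QuantumLattice.fundamentalRep (Fin 3))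 U m 1).mulVec v i‖ ^ 2 ≤ lam * ∑ i, ‖v i‖ ^ 2) → (Module.finrank ℂ E : ℝ) ≤ C * (lam ^ 2 * (L : ℝ) ^ 4 + Literature.MathematicalPhysics.QuantumFieldTheory.wilsonAction (Literature.MathematicalPhysics.QuantumLattice.fundamentalRep (Fin 3)) U + 1)

/-- item stmt-QuantumFields-8891 · crux · rank 4 · open · by planner
why it might fail: No fermionic multiscale expansion with a DYNAMICAL non-abelian gauge field in d = 4 exists (BOS: external field; Dimock: abelian d = 3): the marginal rough fermion–fluctuation vertex carries the linearly divergent mass shift, cancelled scale by scale in the flow; large fields cut the Gram strips.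
sources: doi:10.1007/bf01208817, doi:10.1007/bf01464282, Balaban1987RG1, Balaban1988Convergent, Balaban1989LargeFieldII, BalabanOcarrollSchor1989
[crux] INTERLEAVED HEAT-SLICE FLOW (card K3; engine glue into the target ContinuumQCDExists):
interleave Bałaban's SU(3) gauge block-averaging steps with Gawędzki–Kupiainen /
Feldman–Magnen–Rivasseau–Sénéor fermionic slice integrations whose covariances are the heat slices
C_j(U_j) = ∫_{L^{2j}}^{L^{2j+2}} e^{−t D_W(U_j)†D_W(U_j)} D_W(U_j)† dt of the scale-j BACKGROUND
field U_j (not the rough field); inputs: SmallFieldUltracontractivity (free Gram power counting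
|C_j(x,y)| ≤ C L^{−3j} e^{−c d(x,y)/L^j} on Bałaban small-field regions, constants independent of
the background by DaviesGaffneyWilson) and ActionBoundsLowModes (inside large-field regions the
number of quark modes below L^{−2j} in excess of the Weyl count is ≤ C·(local Wilson action), paid
by Bałaban's e^{−β_j·action} weights linearly in the mode count); output: effective densities
bounded uniformly in k along β_k with two-loop asymptotic scaling INCLUDING the quark loop (b₀ = (11
− 2N_f/3)/16π²), m_crit(k) and Z_m(k) tuned inside the flow with QCDRegularisation.HasMassScaling,
fermionic kernels real-analytic in the background field; with SU(3) Bałaban UV stability this yields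
ContinuumQCDExists (sequential limits, OS axi -/
@[route_item "route-QuantumFields-HeatSlicedQuarks", crux]
def InterleavedHeatSliceFlow : Prop :=
  SmallFieldUltracontractivity → ActionBoundsLowModes → ContinuumQCDExists

/-- item stmt-QuantumFields-8892 · crux · rank 5 · open · by planner
why it might fail: Contains SU(3) robust Yang–Mills (open) AND, since re-type p117723 (its conclusion QCD conjoins reg.IsChiralAtZero), a chiral point ON X₀'s own bare trajectory with lattice+continuum gaps at every mass above it and gap→0 at it: light-quark/Goldstone physics no heavy-threshold argument reaches.
sources: JaffeWitten2000, JaffeWittenClay2006, Balaban1988Convergent, MontvayMunster1994, Literature.MathematicalPhysics.QuantumFieldTheory.LatticeMassGapAllCouplings, SharpeSingleton1998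
[crux] ROBUST YANG–MILLS HANDOVER (card K4, conditional flavour; the arrow ContinuumQCDExists → QCD
of the Assembly): below the quark scale min_f 1/(a_k m_f) all quarks are heavy in current lattice
units (numerical range of the scale-j* effective Dirac operator ≥ c > 0, AccretiveWilsonDirac-type
coercivity of the TUNED flow), so the residual Grassmann integral is a convergent heavy-hopping /
polymer expansion producing a gauge-invariant quasi-local perturbation δS of the Bałaban effective
SU(3) action with norm η(j*) → 0 as k → ∞; ROBUST YM: the SU(3) Yang–Mills construction — sequential
continuum limit of all gauge-invariant correlators with E0–E4, non-trivial non-Gaussian tr F²,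
uniform lattice gap Δ_YM on all tori — is stable under such perturbations, and flavour-changing
channels inherit a gap ≥ min(Δ_YM/2, c·m_f); delivers T.HasMassGap Δ and (reg.scheme m z
shift).HasLatticeMassGap Δ for the same scheme, i.e. ContinuumQCDExists → QCD (= QCDOf 2 ∧ QCDOf 3).
WHY IT MIGHT FAIL: it contains the YangMills conjunct for SU(3) plus universality with respect to
arbitrarily small quasi-local gauge-invariant action perturbations, both open
(Literature.Barriers.QuantumFields.PerturbativeI -/
@[route_item "route-QuantumFields-HeatSlicedQuarks", crux]
def RobustYangMillsHandover : Prop :=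
  ContinuumQCDExists → _root_.QCD

/-- item stmt-QuantumFields-17985 · crux · rank 6 · closed · proved by Summit.QuantumFields.QCD.Cruxes.TracedQuadraticParametrix.Sketch.TracedQuadraticParametrix_of @ a89bcfb7e230 (prover) · by planner
why it might fail: First-order term survives the trace via Re tr(W−1) ≍ (d+1)²δ²; its d²-growth in the comb gauge eats a factor t of smoothing budget — a log t loss (as in retired r3 ParametrixCore) breaks uniformity at t ≍ r², where the coefficient is read.
sources: doi:10.1016/j.physrep.2003.09.002, doi:10.1007/bf01215753, Davies1989, MontvayMunster1994
[crux] TRACED QUADRATIC PARAMETRIX (next Duhamel order of the landed chain ParametrixDiagonalLog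
p112612 / ColumnIdentification p111007): under GLOBAL scale-covariant smallness (all plaquette
deficits ≤ (ε/r²)², 1 ≤ r ≤ L, m ∈ [−1/2,1]) the colour–spin TRACE of the on-diagonal heat-kernel
correction Σ_{a,α} Re[e^{−tH_U} − e^{−tH_1}]((x,a,α),(x,a,α)), H = D_Wᴴ D_W, is SECOND order in the
field amplitude: ≤ C(ε/r²)² uniformly in 1 ≤ t ≤ r², plus the landed winding tail C e^{−cL²/(t(1+log
t)²)}/t². Mechanism: su(3) is traceless, so the genuinely linear term of the column Duhamel series
dies in the colour trace; what survives at first order is Re tr(W − 1) = −(link deficit) = O(C_A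
(d+1)² δ²) in the global comb gauge (GlobalCombGauge p105426), and the two-vertex term is (δt)²
relative, i.e. δ² = ε²/r⁴ absolute — the size at which the quark loop's F² coefficient lives
(sibling QuarkLoopCoefficient). Untraced entries are only O(εt/r²)/t² (landed), which at t ≍ r² is
one power of ε short of seeing the coefficient. [deps: SmallFieldUltracontractivity,
DaviesGaffneyWilson] [difficulty: L] -/
@[route_item "route-QuantumFields-HeatSlicedQuarks", crux]
def TracedQuadraticParametrix : Prop :=
  ∃ ε : ℝ, 0 < ε ∧ ∃ C c : ℝ, 0 < c ∧ ∀ (L : ℕ) [NeZero L] (U : Literature.MathematicalPhysics.QuantumFieldTheory.GaugeConfig 4 L (Matrix.specialUnitaryGroup (Fin 3) ℂ)) (m : ℝ), m ∈ Set.Icc (-(1 / 2 : ℝ)) 1 → ∀ (r : ℕ), 1 ≤ r → r ≤ L → (∀ (y : Literature.Probability.LatticeModels.TorusSite 4 L) (μ ν : Fin 4), 3 - ((Literature.MathematicalPhysics.QuantumLattice.fundamentalRep (Fin 3)) (Literature.MathematicalPhysics.QuantumFieldTheory.plaquetteHolonomy U y μ ν)).trace.re ≤ (ε / (r : ℝ)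 ^ 2) ^ 2) → ∀ (t : ℝ), 1 ≤ t → t ≤ (r : ℝ) ^ 2 → ∀ (x : Literature.Probability.LatticeModels.TorusSite 4 L), |(∑ a : Fin 3, ∑ α : Fin 4, ((NormedSpace.exp (-(t : ℂ) • (Matrix.conjTranspose (Literature.MathematicalPhysics.QuantumLattice.wilsonDirac (Literature.MathematicalPhysics.QuantumLattice.fundamentalRep (Fin 3)) U m 1) * Literature.MathematicalPhysics.QuantumLattice.wilsonDirac (Literature.MathematicalPhysics.QuantumLattice.fundamentalRep (Fin 3)) U m 1))) (x, a, α) (x, a, α)).re) - (∑ a : Fin 3, ∑ α : Fin 4, ((NormedSpace.exp (-(t : ℂ) • (Matrix.conjTranspose (Literature.MathematicalPhysics.QuantumLattice.wilsonDirac (Literature.MathematicalPhysics.QuantumLattice.fundamentalRep (Fin 3)) (fun _ : Literature.MathematicalPhysics.QuantumFieldTheory.Edge 4 L => (1 : Matrix.specialUnitaryGroup (Fin 3) ℂ)) m 1) * Literature.MathematicalPhysics.QuantumLattice.wilsonDirac (Literature.MathematicalPhysics.QuantumLattice.fundamentalRep (Fin 3)) (fun _ : Literature.MathematicalPhysics.QuantumFieldTheory.Edge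 4 L => (1 : Matrix.specialUnitaryGroup (Fin 3) ℂ)) m 1))) (x, a, α) (x, a, α)).re)| ≤ C * (ε / (r : ℝ) ^ 2) ^ 2 + C * Real.exp (-(c * (L : ℝ) ^ 2 / (t * (1 + Real.log t) ^ 2))) / t ^ 2

-- earlier QuarkLoopCoefficient (stmt-QuantumFields-17986, replaced 2026-08-17T00:24:19Z -> stmt-QuantumFields-16786): retired by None — ∃ C c : ℝ, 0 < c ∧ ∀ (L : ℕ) [NeZero L] (U : Literature.MathematicalPhysics.QuantumFieldTheory.GaugeConfig 4 L (Matrix.specialUnitaryGroup (Fin 3) ℂ)) (θ : ℝ), (∀ (e : Literature.MathematicalPhysics.QuantumFieldTheory.Edge 4 L) (i j : Fin 3), i ≠ j → (Literature.Mat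
/-- item stmt-QuantumFields-16786 · crux · rank 7 · closed · proved by Summit.QuantumFields.QCD.Cruxes.QuarkLoopCoefficient.Sketch.QuarkLoopCoefficient_of @ 29e815037e45 (prover) · by planner
why it might fail: t⁰ coefficient must be EXACTLY the continuum a₂ with an O(θ²/t), log-free lattice remainder (single-γ Wilson-commutator argument; numerics 0.93 at t ≤ 4 only, j020996 pending); free Polyakov phases/AB images must fit e^{−cL²/(t+L)}/t² (flat slice checked); uniformity on θt ≤ 1 needs Harper blocks.
sources: doi:10.1016/0550-3213(81)90080-8, doi:10.1016/0550-3213(81)90371-0, doi:10.1016/j.physrep.2003.09.002, doi:10.1016/0550-3213(85)90002-1, MontvayMunster1994, Davies1989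
[crux] QUARK-LOOP COEFFICIENT FROM THE LATTICE HEAT KERNEL (background-field certificate of the
marginal flow; REPAIRED 2026-08-17 after the toron refutation of item 17986 — the finite-volume tail
is now the Davies–Gaffney envelope): for every SU(3) configuration on the 4-torus with
Cartan-diagonal links, constant plaquette diag(e^{iθ}, e^{−iθ}, 1) in the (0,1)-plane and all other
plaquettes trivial (covariantly constant abelian flux; exists iff θL² ∈ 2πℤ; the Polyakov phases are
NOT fixed by the hypotheses and enter only through winding images), the colour–spin traced
on-diagonal correction of the massless Wilson heat kernel obeys |Σ_{a,α} Re[e^{−tH_U} −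
e^{−tH_1}](x,x) − (1 − cos θ)/(3π²)| ≤ Cθ²(1/t + θ²t²) + C e^{−cL²/(t+L)}/t² for 1 ≤ t ≤ L², t|θ| ≤
1 — i.e. up to lattice artefacts O(θ²/t), the Landau remainder O(θ⁴t²) and torus images (Poissonian
~ t^L e^{−2t}/L! for t ≲ L, Gaussian e^{−L²/4t} for t ≳ L — Davies 1993 large deviations on graphs;
the flat toron at θ = 0 has odd-winding images |F(L,1)| ≥ 32e^{−2}/(L³L!), which beat the
Gaussian-only tail of 17986 and sit inside this envelope; flat slice checked exactly:
sup_{t,φ}|F|t²e^{cL²/(t+L)} ≈ 8e^{c} for c ≤ 0.45, L ≤ 48) t -/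
@[route_item "route-QuantumFields-HeatSlicedQuarks", crux]
def QuarkLoopCoefficient : Prop :=
  ∃ C c : ℝ, 0 < c ∧ ∀ (L : ℕ) [NeZero L] (U : Literature.MathematicalPhysics.QuantumFieldTheory.GaugeConfig 4 L (Matrix.specialUnitaryGroup (Fin 3) ℂ)) (θ : ℝ), (∀ (e : Literature.MathematicalPhysics.QuantumFieldTheory.Edge 4 L) (i j : Fin 3), i ≠ j → (Literature.MathematicalPhysics.QuantumLattice.fundamentalRep (Fin 3)) (U e) i j = 0) → (∀ y : Literature.Probability.LatticeModels.TorusSite 4 L, (Literature.MathematicalPhysics.QuantumLattice.fundamentalRep (Fin 3)) (Literature.MathematicalPhysics.QuantumFieldTheory.plaquetteHolonomy U y 0 1) = Matrix.diagonal ![Complex.exp (Complex.I * θ), Complex.exp (-(Complex.I * θ)), 1]) → (∀ (y : Literature.Probability.LatticeModels.TorusSite 4 L) (μ ν : Fin 4), ¬(μ = 0 ∧ ν = 1) → ¬(μ = 1 ∧ ν = 0) → Literature.MathematicalPhysics.QuantumFieldTheory.plaquetteHolonomy U y μ ν = 1) → ∀ (t : ℝ), 1 ≤ t → t ≤ (L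 : ℝ) ^ 2 → t * |θ| ≤ 1 → ∀ (x : Literature.Probability.LatticeModels.TorusSite 4 L), |(∑ a : Fin 3, ∑ α : Fin 4, ((NormedSpace.exp (-(t : ℂ) • (Matrix.conjTranspose (Literature.MathematicalPhysics.QuantumLattice.wilsonDirac (Literature.MathematicalPhysics.QuantumLattice.fundamentalRep (Fin 3)) U 0 1) * Literature.MathematicalPhysics.QuantumLattice.wilsonDirac (Literature.MathematicalPhysics.QuantumLattice.fundamentalRep (Fin 3)) U 0 1))) (x, a, α) (x, a, α)).re) - (∑ a : Fin 3, ∑ α : Fin 4, ((NormedSpace.exp (-(t : ℂ) • (Matrix.conjTranspose (Literature.MathematicalPhysics.QuantumLattice.wilsonDirac (Literature.MathematicalPhysics.QuantumLattice.fundamentalRep (Fin 3)) (fun _ : Literature.MathematicalPhysics.QuantumFieldTheory.Edge 4 L => (1 : Matrix.specialUnitaryGroup (Fin 3) ℂ)) 0 1) * Literature.MathematicalPhysics.QuantumLattice.wilsonDirac (Literature.MathematicalPhysics.QuantumLattice.fundamentalRep (Fin 3)) (fun _ : Literature.MathematicalPhysics.QuantumFieldTheory.Edge 4 L => (1 : Matrix.specialUnitaryGroup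 (Fin 3) ℂ)) 0 1))) (x, a, α) (x, a, α)).re) - (1 - Real.cos θ) / (3 * Real.pi ^ 2)| ≤ C * θ ^ 2 * (1 / t + θ ^ 2 * t ^ 2) + C * Real.exp (-(c * (L : ℝ) ^ 2 / (t + (L : ℝ)))) / t ^ 2

-- earlier InterleavedFlowProper (stmt-QuantumFields-17988, replaced 2026-08-16T23:48:32Z -> stmt-QuantumFields-18031): retired by None — TracedQuadraticParametrix → QuarkLoopCoefficient → QuarkSliceStability → InterleavedHeatSliceFlow
/-- item stmt-QuantumFields-18031 · crux · rank 8 · open · by planner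
why it might fail: It IS X₀ given two lattice lemmas: no fermionic multiscale expansion with a dynamical non-abelian gauge field in d = 4 exists (rough fermion–fluctuation vertex with the linear mass shift; large fields cut Gram strips; SU(3) Bałaban steps unwritten; E1 open); trivial again if 17985/16786 false.
sources: Balaban1988Convergent, Balaban1989LargeFieldII, BalabanOcarrollSchor1989, doi:10.1063/1.529479, doi:10.1007/s00023-021-01127-z, doi:10.1063/1.5009458
[crux, X₀-HARD, declared] INTERLEAVED FLOW PROPER — the glue TracedQuadraticParametrix →
QuarkLoopCoefficient → InterleavedHeatSliceFlow (and InterleavedHeatSliceFlow ≡ ContinuumQCDExists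
since 8871/8872 closed, p96451; the support QuarkSliceStability, a corollary of 8872, is consumed
inside the proof, not as a hypothesis). Content, named: (i) Bałaban SU(3) block-averaging gauge
steps in d = 4 (CMP 109/119/122 are SU(2); the tree's BalabanUVStability4 is schematic and NOT
asserted — the SU(3) small/large-field step is open content HERE) run at the quark-shifted running
coupling β_j + (N_f/2π²)·log (coefficient certified by QuarkLoopCoefficient, size frame by
TracedQuadraticParametrix, lower stability of the quark slice by the support QuarkSliceStability);
(ii) GK/FMRS fermionic slice integrations with covariances ∫ e^{−tH_{U_j}} D_W† dt whose Gram
constants and analyticity strips in the complexified background are background-free by the PROVED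
engine (8871, 8873; stub_holomorphicGaugeCovariance p85892, stub_squareRootStrip p89245); (iii) the
relevant mass vertex: m_crit(k) tuned in-flow scale by scale (linear divergence, never a series),
Z_m(k) with exponent massExponent N_f (`HasM -/
@[route_item "route-QuantumFields-HeatSlicedQuarks", crux]
def InterleavedFlowProper : Prop :=
  TracedQuadraticParametrix → QuarkLoopCoefficient → InterleavedHeatSliceFlow

/-- item stmt-QuantumFields-17987 · support · rank 9 · closed · proved by Summit.QuantumFields.QCD.Theorems.HeatSlicedQuarks.QuarkSliceStability_proof @ 6c89f7ebf22c (prover) · by planner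
sources: Balaban1988Convergent, doi:10.1007/s10958-009-9436-9, VafaWitten1984CMP
[support] BAŁABAN-FORMAT STABILITY OF THE QUARK SLICE (provable now; corollary of the CLOSED crux
ActionBoundsLowModes 8872 by Laplace transform of the mode count N_U(λ) ≤ C(λ²L⁴ + S_W + 1)): for
every SU(3) field U, m ∈ [−1/2,1], s ≥ 1, b ≥ 1: ∫_s^{bs} (Tr e^{−tH_U} − Tr e^{−tH_1}) dt/t ≤ C
L⁴/s² + C (S_W(U) + 1) log b. Reading: the sliced quark determinant ratio obeys det_slice(U) ≥
det_slice(1)·exp(−C|Λ|_s − C S_W(U) log b) — the fermionic factor of the lower stability bound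
e^{−c|Λ|} ≤ ρ_k in Bałaban's format (extensive constant per block of side √s, plus a log b·S_W
coupling shift bounded by the SAME plaquette action the gauge weight e^{−β S_W} pays with), for ALL
fields, no smallness. [deps: ActionBoundsLowModes] [difficulty: provable-now] -/
@[route_item "route-QuantumFields-HeatSlicedQuarks"]
def QuarkSliceStability : Prop :=
  ∃ C : ℝ, ∀ (L : ℕ) [NeZero L] (U : Literature.MathematicalPhysics.QuantumFieldTheory.GaugeConfig 4 L (Matrix.specialUnitaryGroup (Fin 3) ℂ)) (m : ℝ), m ∈ Set.Icc (-(1 / 2 : ℝ)) 1 → ∀ (s : ℝ), 1 ≤ s → ∀ (b : ℝ), 1 ≤ b → ∫ t in s..(b * s), ((Matrix.trace (NormedSpace.exp (-(t : ℂ) • (Matrix.conjTranspose (Literature.MathematicalPhysics.QuantumLattice.wilsonDirac (Literature.MathematicalPhysics.QuantumLattice.fundamentalRep (Fin 3)) U m 1) * Literature.MathematicalPhysics.QuantumLattice.wilsonDirac (Literature.MathematicalPhysics.QuantumLattice.fundamentalRep (Fin 3)) U m 1)))).re - (Matrix.trace (NormedSpace.exp (-(t : ℂ) • (Matrix.conjTranspose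 (Literature.MathematicalPhysics.QuantumLattice.wilsonDirac (Literature.MathematicalPhysics.QuantumLattice.fundamentalRep (Fin 3)) (fun _ : Literature.MathematicalPhysics.QuantumFieldTheory.Edge 4 L => (1 : Matrix.specialUnitaryGroup (Fin 3) ℂ)) m 1) * Literature.MathematicalPhysics.QuantumLattice.wilsonDirac (Literature.MathematicalPhysics.QuantumLattice.fundamentalRep (Fin 3)) (fun _ : Literature.MathematicalPhysics.QuantumFieldTheory.Edge 4 L => (1 : Matrix.specialUnitaryGroup (Fin 3) ℂ)) m 1)))).re) / t ≤ C * (L : ℝ) ^ 4 / s ^ 2 + C * (Literature.MathematicalPhysics.QuantumFieldTheory.wilsonAction (Literature.MathematicalPhysics.QuantumLattice.fundamentalRep (Fin 3)) U + 1) * Real.log b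

/-- item stmt-QuantumFields-8873 · support · rank 9 · closed · proved by Summit.QuantumFields.QCD.Theorems.DaviesGaffneyWilson_proof (prover) · by planner
sources: doi:10.1017/9781107415690, doi:10.1112/jlms/s2-47.1.65, Davies1989, Delmotte1999
[support] U-UNIFORM DAVIES–GAFFNEY (card P1): constants C, c > 0 with |e^{−tH_U}((x,a,α),(y,b,β))| ≤
C·exp(−c·d²/(t + d)), d = torusDist x y, for all L, all SU(3) configurations U, m ∈ [−1, 1], t ≥ 0 —
Gaussian for d ≲ t, Poisson/exponential beyond; proof = Carne–Varopoulos Chebyshev argument for the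
self-adjoint contraction 1 − H_U/h₀ (range 2, h₀ a U-independent bound on ‖H_U‖ since links are
unitary and (1∓γ_μ)/2 are projectors) plus Poisson tails. [difficulty: provable-now] -/
@[route_item "route-QuantumFields-HeatSlicedQuarks"]
def DaviesGaffneyWilson : Prop :=
  ∃ C c : ℝ, 0 < c ∧ ∀ (L : ℕ) [NeZero L] (U : Literature.MathematicalPhysics.QuantumFieldTheory.GaugeConfig 4 L (Matrix.specialUnitaryGroup (Fin 3) ℂ)) (m : ℝ), m ∈ Set.Icc (-1 : ℝ) 1 → ∀ (t : ℝ), 0 ≤ t → ∀ (x y : Literature.Probability.LatticeModels.TorusSite 4 L) (a b : Fin 3) (α β : Fin 4), ‖(NormedSpace.exp (-(t : ℂ) • (Matrix.conjTranspose (Literature.MathematicalPhysics.QuantumLattice.wilsonDirac (Literature.MathematicalPhysics.QuantumLattice.fundamentalRep (Fin 3)) U m 1) * Literature.MathematicalPhysics.QuantumLattice.wilsonDirac (Literature.MathematicalPhysics.QuantumLattice.fundamentalRep (Fin 3)) U m 1))) (x, a, α) (y, b, β)‖ ≤ C * Real.exp (-(c * (Literature.MathematicalPhysics.QuantumLattice.torusDist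 x y : ℝ) ^ 2 / (t + (Literature.MathematicalPhysics.QuantumLattice.torusDist x y : ℝ))))

/-- item stmt-QuantumFields-8874 · support · rank 9 · closed · proved by Summit.QuantumFields.QCD.Theorems.wilsonLichnerowicz_proof (prover) · by planner
sources: MontvayMunster1994, doi:10.1103/physrevd.61.085015, doi:10.1103/physrevd.68.065009
[support] LATTICE LICHNEROWICZ FORM BOUND: D_W = A + B with A = m + ½K_U Hermitian (K_U the
covariant Laplacian form Σ‖U_μ(x)v(x+μ) − v(x)‖²) and B = ½Σγ_μ(∇_μ − ∇_μ†) anti-Hermitian; ‖D_W v‖²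
= ‖Av‖² + ‖Bv‖² + ⟨v,[A,B]v⟩, the single-direction identity (∇−∇†)†(∇−∇†) = K_μ(4 − K_μ) and
commutators [∇_μ, ∇_ν] = O(1 − U_p) give, for m ∈ [−1/2, 1], ½⟨v,K_U v⟩ ≤ ‖D_W v‖² + C Σ_x
V(U,x)‖v(x)‖² with V(U,x) = Σ over plaquettes based within torus distance 3 of x of √(3 − Re tr U_p)
and an ABSOLUTE constant C — the common root of cruxes 2 and 3. [difficulty: M] -/
@[route_item "route-QuantumFields-HeatSlicedQuarks"]
def WilsonLichnerowicz : Prop :=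
  ∃ C : ℝ, ∀ (L : ℕ) [NeZero L] (U : Literature.MathematicalPhysics.QuantumFieldTheory.GaugeConfig 4 L (Matrix.specialUnitaryGroup (Fin 3) ℂ)) (m : ℝ), m ∈ Set.Icc (-(1 / 2 : ℝ)) 1 → ∀ (v : Literature.Probability.LatticeModels.TorusSite 4 L × Fin 3 × Fin 4 → ℂ), (1 / 2 : ℝ) * ∑ x : Literature.Probability.LatticeModels.TorusSite 4 L, ∑ μ : Fin 4, ∑ a : Fin 3, ∑ α : Fin 4, ‖(∑ b : Fin 3, (Literature.MathematicalPhysics.QuantumLattice.fundamentalRep (Fin 3) (U (x, μ))) a b * v (Literature.MathematicalPhysics.QuantumFieldTheory.Site.shift x μ, b, α)) - v (x, a, α)‖ ^ 2 ≤ (∑ i, ‖(Literature.MathematicalPhysics.QuantumLattice.wilsonDirac (Literature.MathematicalPhysics.QuantumLattice.fundamentalRep (Fin 3)) U m 1).mulVec v i‖ ^ 2) + C * ∑ x : Literature.Probability.LatticeModels.TorusSite 4 L, (∑ y ∈ Finset.univ.filter (fun y : Literature.Probability.LatticeModels.TorusSite 4 L => Literature.MathematicalPhysics.QuantumLattice.torusDist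 x y ≤ 3), ∑ μ : Fin 4, ∑ ν : Fin 4, Real.sqrt (3 - ((Literature.MathematicalPhysics.QuantumLattice.fundamentalRep (Fin 3)) (Literature.MathematicalPhysics.QuantumFieldTheory.plaquetteHolonomy U y μ ν)).trace.re)) * ∑ a : Fin 3, ∑ α : Fin 4, ‖v (x, a, α)‖ ^ 2

/-- item stmt-QuantumFields-8875 · support · rank 9 · closed · proved by Summit.QuantumFields.QCD.Theorems.HeatSlicedQuarksAccretiveWilsonDirac.accretiveWilsonDirac_proof (prover) · by planner
sources: MontvayMunster1994, Wilson1975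
[support] WILSON-TERM ACCRETIVITY (exact identity, validates the tree's conventions): Re⟨v,
D_W(U,m,1)v⟩ = m‖v‖² + ½Σ_{x,μ}‖U(x,μ)v(x+μ) − v(x)‖² for every U, m, v; hence ‖e^{−tD_W}‖ ≤ e^{−tm}
and ‖D_W⁻¹‖ ≤ 1/m for m > 0 uniformly in U (the m > 0 infrared remainder), and zero modes at m = 0
force U pure gauge on the support. [difficulty: provable-now] -/
@[route_item "route-QuantumFields-HeatSlicedQuarks"]
def AccretiveWilsonDirac : Prop :=
  ∀ (L : ℕ) [NeZero L] (U : Literature.MathematicalPhysics.QuantumFieldTheory.GaugeConfig 4 L (Matrix.specialUnitaryGroup (Fin 3) ℂ)) (m : ℝ) (v : Literature.Probability.LatticeModels.TorusSite 4 L × Fin 3 × Fin 4 → ℂ), (∑ i, star (v i) * (Literature.MathematicalPhysics.QuantumLattice.wilsonDirac (Literature.MathematicalPhysics.QuantumLattice.fundamentalRep (Fin 3)) U m 1).mulVec v i).re = m * ∑ i, ‖v i‖ ^ 2 + (1 / 2 : ℝ) * ∑ x : Literature.Probability.LatticeModels.TorusSite 4 L, ∑ μ : Fin 4, ∑ a :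 Fin 3, ∑ α : Fin 4, ‖(∑ b : Fin 3, (Literature.MathematicalPhysics.QuantumLattice.fundamentalRep (Fin 3) (U (x, μ))) a b * v (Literature.MathematicalPhysics.QuantumFieldTheory.Site.shift x μ, b, α)) - v (x, a, α)‖ ^ 2

/-- item stmt-QuantumFields-8876 · support · rank 9 · closed · proved by Summit.QuantumFields.QCD.Theorems.HeatSlicedQuarks.UniformLocalSpectralBound_proof (prover) · by planner
sources: Davies1989, VafaWitten1984CMP, doi:10.1007/s10958-009-9436-9
[support] WORST CASE IS BANKS–CASHER RATE (cost of a bad block is polynomial): for m ∈ [0, 1] the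
on-diagonal kernel obeys |e^{−tH_U}((x,a,α),(x,b,β))| ≤ C(t^{−1/2} + L⁻²) for ALL U, t ≥ 1 —
accretivity gives ⟨f,K_U f⟩ ≤ 2√λ on the spectral subspace of H_U below λ, Kato's inequality and the
discrete Sobolev inequality on the 4-torus bound the local density of states by C(√λ + L⁻²), Laplace
transform; saturated by constant abelian flux f ~ t^{−1/4} (Landau levels), so it is sharp and shows
why crux 2 must be scale-covariant. [difficulty: M] -/
@[route_item "route-QuantumFields-HeatSlicedQuarks"]
def UniformLocalSpectralBound : Prop :=
  ∃ C : ℝ, ∀ (L : ℕ) [NeZero L] (U : Literature.MathematicalPhysics.QuantumFieldTheory.GaugeConfig 4 L (Matrix.specialUnitaryGroup (Fin 3) ℂ)) (m : ℝ), m ∈ Set.Icc (0 : ℝ) 1 → ∀ (t : ℝ), 1 ≤ t → ∀ (x : Literature.Probability.LatticeModels.TorusSite 4 L) (a b : Fin 3) (α β : Fin 4), ‖(NormedSpace.exp (-(t : ℂ) • (Matrix.conjTranspose (Literature.MathematicalPhysics.QuantumLattice.wilsonDirac (Literature.MathematicalPhysics.QuantumLattice.fundamentalRep (Fin 3)) U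 m 1) * Literature.MathematicalPhysics.QuantumLattice.wilsonDirac (Literature.MathematicalPhysics.QuantumLattice.fundamentalRep (Fin 3)) U m 1))) (x, a, α) (x, b, β)‖ ≤ C * (1 / Real.sqrt t + 1 / (L : ℝ) ^ 2)

/-- item stmt-QuantumFields-8877 · support · rank 9 · closed · proved by Summit.QuantumFields.QCD.Theorems.HeatSlicedQuarks.FreeKernel.freeKernelPowerCounting_proof (prover) · by planner
sources: MontvayMunster1994, Rivasseau1991
[support] FREE BENCHMARK (card P2): for U ≡ 1, m = 0 and 1 ≤ t ≤ L² the on-diagonal kernel is real,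
diagonal in colour–spin, and two-sided free: c/t² ≤ e^{−tH_1}((x,a,α),(x,a,α)) and all entries ≤
C/t² (Fourier sum on the torus; H(p) = Σ sin²p_μ + (Σ(1 − cos p_μ))² vanishes only at p = 0,
doublers lifted) — pins the exponent 2 that crux 2 must reproduce. [difficulty: provable-now] -/
@[route_item "route-QuantumFields-HeatSlicedQuarks"]
def FreeKernelPowerCounting : Prop :=
  ∃ c C : ℝ, 0 < c ∧ ∀ (L : ℕ) [NeZero L] (t : ℝ), 1 ≤ t → t ≤ (L : ℝ) ^ 2 → ∀ (x : Literature.Probability.LatticeModels.TorusSite 4 L) (a : Fin 3) (α : Fin 4), c / t ^ 2 ≤ ((NormedSpace.exp (-(t : ℂ) • (Matrix.conjTranspose (Literature.MathematicalPhysics.QuantumLattice.wilsonDirac (Literature.MathematicalPhysics.QuantumLattice.fundamentalRep (Fin 3)) (fun _ : Literature.MathematicalPhysics.QuantumFieldTheory.Edge 4 L => (1 : Matrix.specialUnitaryGroup (Fin 3) ℂ)) 0 1) * Literature.MathematicalPhysics.QuantumLattice.wilsonDirac (Literature.MathematicalPhysics.QuantumLattice.fundamentalRep (Fin 3)) (fun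 _ : Literature.MathematicalPhysics.QuantumFieldTheory.Edge 4 L => (1 : Matrix.specialUnitaryGroup (Fin 3) ℂ)) 0 1))) (x, a, α) (x, a, α)).re ∧ ∀ (b : Fin 3) (β : Fin 4), ‖(NormedSpace.exp (-(t : ℂ) • (Matrix.conjTranspose (Literature.MathematicalPhysics.QuantumLattice.wilsonDirac (Literature.MathematicalPhysics.QuantumLattice.fundamentalRep (Fin 3)) (fun _ : Literature.MathematicalPhysics.QuantumFieldTheory.Edge 4 L => (1 : Matrix.specialUnitaryGroup (Fin 3) ℂ)) 0 1) * Literature.MathematicalPhysics.QuantumLattice.wilsonDirac (Literature.MathematicalPhysics.QuantumLattice.fundamentalRep (Fin 3)) (fun _ : Literature.MathematicalPhysics.QuantumFieldTheory.Edge 4 L => (1 : Matrix.specialUnitaryGroup (Fin 3) ℂ)) 0 1))) (x, a, α) (x, b, β)‖ ≤ C / t ^ 2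

/-- item stmt-QuantumFields-8878 · assembly · rank 1 · open · by planner
sources: JaffeWitten2000, Balaban1988Convergent, MagnenRivasseauSeneor1993
[assembly] SmallFieldUltracontractivity → ActionBoundsLowModes → ContinuumQCDExists → QCD (the last
arrow is RobustYangMillsHandover; the engine arrows into ContinuumQCDExists are
InterleavedHeatSliceFlow). -/
@[route_item "route-QuantumFields-HeatSlicedQuarks"]
def Assembly : Prop :=
  SmallFieldUltracontractivity → ActionBoundsLowModes → ContinuumQCDExists → QCD

/-! D-0027 §2.1 — DECIDING THEOREM (planner-authored via `route open/edit --closes-file`; by planner-promote-QuantumFields-HeatSlicedQuarks-a957f707-0 2026-08-16T23:49:59Z):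
its hypotheses are this route's items and its conclusion the sub-problem Statement (glue_lint), and it elaborates with this file. -/

/-- D-0027 §2.1 deciding theorem of route HeatSlicedQuarks (pure logic), re-cut 2026-08-16 after the two
spectral engine cruxes CLOSED (SmallFieldUltracontractivity 8871 — the tier-deciding crux — and
ActionBoundsLowModes 8872, both theorems of the tree). The old engine glue
`InterleavedHeatSliceFlow : SFU → ABLM → ContinuumQCDExists` is ≡ X₀ given those theorems (p96451), so it is
no longer a hypothesis: it is DERIVED from two typed lattice milestones strictly weaker than X₀ —
`TracedQuadraticParametrix` (the colour–spin traced on-diagonal heat-kernel correction is O((ε/r²)²)) and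
`QuarkLoopCoefficient` (in constant Cartan flux that traced correction IS P(x)/(6π²): the quark loop's b₀
coefficient read off the lattice heat kernel) — through the declared, honestly X₀-hard glue
`InterleavedFlowProper : TracedQuadraticParametrix → QuarkLoopCoefficient → InterleavedHeatSliceFlow` (the
interleaved Bałaban-SU(3)/GK–FMRS construction proper; its open content is named in its docstring; the support
`QuarkSliceStability`, a corollary of 8872, is consumed inside its proof). The completion
`RobustYangMillsHandover : ContinuumQCDExists → QCD` (pinned threshold) supplies gaps and chirality.
`QCD := QCDOf 2 ∧ QCDOf 3` follows by modus ponens (axioms propext / Classical.choice / Quot.sound). -/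
@[closes "route-QuantumFields-HeatSlicedQuarks"] theorem closes (h2 : SmallFieldUltracontractivity) (h3 : ActionBoundsLowModes)
    (h4a : TracedQuadraticParametrix) (h4b : QuarkLoopCoefficient) (h4g : InterleavedFlowProper)
    (h5 : RobustYangMillsHandover) : _root_.QCD :=
  h5 (h4g h4a h4b h2 h3)

end Summit.QuantumFields.QCD.Theses.HeatSlicedQuarks
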